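import Mathlib.LinearAlgebra.Complex.FiniteDimensional
import Literature.Topology.Euclidean.InvarianceOfDomain
import HarnessLib

/-!
# Brouwer's invariance of dimension

**Theorem** (Brouwer 1911, *Beweis der Invarianz der Dimensionenzahl*; Tao, *Hilbert's Fifth
Problem and Related Topics*, §6.2, consequence of Thm. 6.0.12). If a non-empty open subset of
`ℝᵐ` maps continuously and injectively into `ℝⁿ`, then `m ≤ n`. Consequently two finite-dimensional
real normed spaces carrying homeomorphic non-empty open subsets have the same dimension.

Everything is deduced from the tree's invariance of domain
(`Literature.Topology.Euclidean.Brouwer.isOpen_image_of_injOn`, file `InvarianceOfDomain.lean`):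
if `dim F < dim E`, pad `F` by `ℝ^{dim E - dim F}` and look at `x ↦ (f x, 0)`, a continuous
injection `U → F × ℝ^{dim E - dim F}` between spaces of the same dimension whose image lies in the
slice `F × {0}` and so cannot be open.

Main results (namespace `Literature.Topology.Euclidean.Brouwer`, finite-dimensional real normed
spaces `E`, `F`):

* `finrank_le_of_injOn_of_isOpen` — `U ⊆ E` open and non-empty, `f` continuous and injective on
  `U` ⇒ `finrank ℝ E ≤ finrank ℝ F`;
* `finrank_le_of_continuous_injective` — global form;
* `finrank_eq_of_openPartialHomeomorph` — an `OpenPartialHomeomorph E F` with non-empty source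
  forces `finrank ℝ E = finrank ℝ F`;
* `finrank_eq_of_homeomorph_of_isOpen` — homeomorphic open subsets, one of them non-empty, force
  equal dimensions;
* `finrank_complex_le_of_injOn_of_isOpen`, `finrank_complex_eq_of_openPartialHomeomorph` — the
  same for complex normed spaces (`finrank ℂ`).

No definitions. Mathlib (v4.32.0) has neither invariance of domain nor invariance of dimension
for continuous maps (it has the linear-algebra statement `LinearMap.finrank_le_finrank_of_injective`
only).

## References

* L. E. J. Brouwer, *Beweis der Invarianz der Dimensionenzahl*, Math. Ann. 70 (1911), 161–165
  [Brouwer1911Dimension].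
* T. Tao, *Hilbert's Fifth Problem and Related Topics*, GSM 153 (2014), §6.2, Thm. 6.0.12
  [Tao2014].
-/

open Set Filter Topology

namespace Literature.Topology.Euclidean.Brouwer

section Dimension

variable {E F : Type*} [NormedAddCommGroup E] [NormedSpace ℝ E] [FiniteDimensional ℝ E]
  [NormedAddCommGroup F] [NormedSpace ℝ F] [FiniteDimensional ℝ F]

/-- **Brouwer's invariance of dimension.** If `U ⊆ E` is open and non-empty and `f : E → F` is
continuous and injective on `U` (`E`, `F` finite-dimensional real normed spaces), then
`dim E ≤ dim F`. Proof: otherwise `x ↦ (f x, 0) : E → F × ℝ^{dim E - dim F}` is a continuous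
injection on `U` between spaces of equal dimension, so its image is open by invariance of domain
(`isOpen_image_of_injOn`); but the image lies in `F × {0}`, which contains no neighbourhood of
any of its points. [cite: Brouwer1911Dimension, Satz 1 (p. 161)] -/
theorem finrank_le_of_injOn_of_isOpen {f : E → F} {U : Set E} (hU : IsOpen U)
    (hne : U.Nonempty) (hf : ContinuousOn f U) (hinj : InjOn f U) :
    Module.finrank ℝ E ≤ Module.finrank ℝ F := by
  by_contra hlt
  rw [not_le] at hlt
  obtain ⟨x, hx⟩ := hne
  -- pad `F` to the dimension of `E`
  set k : ℕ := Module.finrank ℝ E - Module.finrank ℝ F with hk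
  have hkpos : 0 < k := Nat.sub_pos_of_lt hlt
  have hdim : Module.finrank ℝ E = Module.finrank ℝ (F × (Fin k → ℝ)) := by
    rw [Module.finrank_prod, Module.finrank_fin_fun, hk]
    omega
  set g : E → F × (Fin k → ℝ) := fun y => (f y, 0) with hg
  have hgc : ContinuousOn g U := hf.prodMk continuousOn_const
  have hginj : InjOn g U := fun y hy z hz hyz => hinj hy hz (congrArg Prod.fst hyz)
  have hopen : IsOpen (g '' U) := isOpen_image_of_injOn hdim hU hgc hginj
  -- the image is a neighbourhood of `(f x, 0)`; move off the slice `F × {0}`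
  have hmem : g '' U ∈ 𝓝 (f x, (0 : Fin k → ℝ)) := hopen.mem_nhds ⟨x, hx, rfl⟩
  set c : ℝ → F × (Fin k → ℝ) := fun t => (f x, fun _ => t) with hc
  have hcc : Continuous c := continuous_const.prodMk (continuous_pi fun _ => continuous_id)
  have hc0 : c 0 = (f x, (0 : Fin k → ℝ)) := rfl
  have hpre : c ⁻¹' (g '' U) ∈ 𝓝 (0 : ℝ) := hcc.continuousAt.preimage_mem_nhds (by rwa [hc0])
  obtain ⟨ε, hε, hball⟩ := Metric.mem_nhds_iff.mp hpre
  have hε2 : (ε / 2 : ℝ) ∈ Metric.ball (0 : ℝ) ε := by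
    rw [Metric.mem_ball, dist_zero_right, Real.norm_of_nonneg (by positivity)]
    linarith
  obtain ⟨y, -, hy⟩ := hball hε2
  have h2 : (g y).2 = (c (ε / 2)).2 := by rw [hy]
  have h3 : (0 : Fin k → ℝ) ⟨0, hkpos⟩ = ε / 2 := congrFun h2 ⟨0, hkpos⟩
  simp only [Pi.zero_apply] at h3
  linarith

/-- **Invariance of dimension, global form**: a continuous injection `E → F` of
finite-dimensional real normed spaces (with `E ≠ 0` or not — the empty case is vacuous since `E`
is non-empty) forces `dim E ≤ dim F`. [cite: Brouwer1911Dimension, Satz 1 (p. 161)] -/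
theorem finrank_le_of_continuous_injective {f : E → F} (hf : Continuous f)
    (hinj : Function.Injective f) : Module.finrank ℝ E ≤ Module.finrank ℝ F :=
  finrank_le_of_injOn_of_isOpen isOpen_univ univ_nonempty hf.continuousOn hinj.injOn

/-- **Homeomorphic non-empty open pieces force equal dimensions** (partial-homeomorphism form):
an `OpenPartialHomeomorph E F` between finite-dimensional real normed spaces with non-empty
source forces `dim E = dim F` — invariance of dimension applied to `e` on `e.source` and to
`e.symm` on `e.target`. [cite: Brouwer1911Dimension, Satz 1 (p. 161)] -/
theorem finrank_eq_of_openPartialHomeomorph (e : OpenPartialHomeomorph E F)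
    (hne : e.source.Nonempty) : Module.finrank ℝ E = Module.finrank ℝ F := by
  refine le_antisymm ?_ ?_
  · exact finrank_le_of_injOn_of_isOpen e.open_source hne e.continuousOn e.injOn
  · obtain ⟨x, hx⟩ := hne
    exact finrank_le_of_injOn_of_isOpen e.open_target ⟨e x, e.map_source hx⟩ e.continuousOn_symm
      e.symm.injOn

/-- **Homeomorphic non-empty open subsets force equal dimensions**: if `U ⊆ E` and `V ⊆ F` are
open, `U` is non-empty and `U ≃ₜ V`, then `dim E = dim F`.
[cite: Brouwer1911Dimension, Satz 1 (p. 161)] -/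
theorem finrank_eq_of_homeomorph_of_isOpen {U : Set E} {V : Set F} (hU : IsOpen U)
    (hV : IsOpen V) (hne : U.Nonempty) (e : U ≃ₜ V) :
    Module.finrank ℝ E = Module.finrank ℝ F := by
  classical
  -- the two global extensions (by junk values off `U`, `V`) are continuous injections on `U`, `V`
  obtain ⟨x₀, hx₀⟩ := hne
  refine le_antisymm ?_ ?_
  · let f : E → F := fun x => if h : x ∈ U then (e ⟨x, h⟩ : F) else (e ⟨x₀, hx₀⟩ : F)
    have hfU : ∀ x (h : x ∈ U), f x = e ⟨x, h⟩ := fun x h => dif_pos h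
    have hfc : ContinuousOn f U := by
      rw [continuousOn_iff_continuous_restrict]
      have : U.restrict f = (fun v : V => (v : F)) ∘ e := by
        funext x; simp [Set.restrict, hfU x x.2]
      rw [this]
      exact continuous_subtype_val.comp e.continuous
    have hfinj : InjOn f U := by
      intro x hx y hy hxy
      rw [hfU x hx, hfU y hy] at hxy
      exact congrArg Subtype.val (e.injective (Subtype.ext hxy))
    exact finrank_le_of_injOn_of_isOpen hU ⟨x₀, hx₀⟩ hfc hfinj
  · let y₀ : V := e ⟨x₀, hx₀⟩
    let g : F → E := fun y => if h : y ∈ V then (e.symm ⟨y, h⟩ : E) else (e.symm y₀ : E)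
    have hgV : ∀ y (h : y ∈ V), g y = e.symm ⟨y, h⟩ := fun y h => dif_pos h
    have hgc : ContinuousOn g V := by
      rw [continuousOn_iff_continuous_restrict]
      have : V.restrict g = (fun u : U => (u : E)) ∘ e.symm := by
        funext y; simp [Set.restrict, hgV y y.2]
      rw [this]
      exact continuous_subtype_val.comp e.symm.continuous
    have hginj : InjOn g V := by
      intro x hx y hy hxy
      rw [hgV x hx, hgV y hy] at hxy
      exact congrArg Subtype.val (e.symm.injective (Subtype.ext hxy))
    exact finrank_le_of_injOn_of_isOpen hV ⟨y₀, y₀.2⟩ hgc hginj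

end Dimension

section Complex

variable {E F : Type*} [NormedAddCommGroup E] [NormedSpace ℂ E] [FiniteDimensional ℂ E]
  [NormedAddCommGroup F] [NormedSpace ℂ F] [FiniteDimensional ℂ F]

/-- **Invariance of dimension for complex normed spaces** (complex dimensions are half the real
ones): a continuous injection on a non-empty open subset of a finite-dimensional complex normed
space `E` into `F` forces `finrank ℂ E ≤ finrank ℂ F`. [cite: Brouwer1911Dimension, Satz 1 (p. 161)] -/
theorem finrank_complex_le_of_injOn_of_isOpen {f : E → F} {U : Set E} (hU : IsOpen U)
    (hne : U.Nonempty) (hf : ContinuousOn f U) (hinj : InjOn f U) :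
    Module.finrank ℂ E ≤ Module.finrank ℂ F := by
  letI : NormedSpace ℝ E := NormedSpace.restrictScalars ℝ ℂ E
  letI : NormedSpace ℝ F := NormedSpace.restrictScalars ℝ ℂ F
  haveI : FiniteDimensional ℝ E := Module.Finite.trans ℂ E
  haveI : FiniteDimensional ℝ F := Module.Finite.trans ℂ F
  have h := finrank_le_of_injOn_of_isOpen hU hne hf hinj
  have hE := Module.finrank_mul_finrank ℝ ℂ E
  have hF := Module.finrank_mul_finrank ℝ ℂ F
  rw [Complex.finrank_real_complex] at hE hF
  omega

/-- **Invariance of dimension for complex normed spaces**, partial-homeomorphism form: an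
`OpenPartialHomeomorph E F` with non-empty source between finite-dimensional complex normed
spaces forces `finrank ℂ E = finrank ℂ F`. [cite: Brouwer1911Dimension, Satz 1 (p. 161)] -/
theorem finrank_complex_eq_of_openPartialHomeomorph (e : OpenPartialHomeomorph E F)
    (hne : e.source.Nonempty) : Module.finrank ℂ E = Module.finrank ℂ F := by
  letI : NormedSpace ℝ E := NormedSpace.restrictScalars ℝ ℂ E
  letI : NormedSpace ℝ F := NormedSpace.restrictScalars ℝ ℂ F
  haveI : FiniteDimensional ℝ E := Module.Finite.trans ℂ E
  haveI : FiniteDimensional ℝ F := Module.Finite.trans ℂ F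
  have h := finrank_eq_of_openPartialHomeomorph e hne
  have hE := Module.finrank_mul_finrank ℝ ℂ E
  have hF := Module.finrank_mul_finrank ℝ ℂ F
  rw [Complex.finrank_real_complex] at hE hF
  omega

end Complex

end Literature.Topology.Euclidean.Brouwer
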